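import Summits.AtomisticToContinuum.Crystallization.Theses.BraggSlacknessRigidity
import Summits.AtomisticToContinuum.Crystallization.Theorems.ThreeConeCertificateExactCertificateFieldInvisible

/-!
# Crux `StrictCertificate` (stmt-AtomisticToContinuum-13167, route `BraggSlacknessRigidity`):
# necessary conditions on a witness — forced Fourier zero at the origin, exact contact sets,
# distance-set rigidity of periodic minimisers

Support file for the line `registered` (lead c3); nothing here closes the item.  For a witness
`⟨P, ρ, c, g, U, f⟩` of the crux (conjuncts 2–7 = a three-cone split `IsSplit ρ c g U f` attaining
`c + f 0/2 = −e_LJ(P)`; conjunct 9 = strictness of the slack `U`; conjunct 11 = integrability of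
`F = f∘‖·‖`), we prove:

* `integral_eq_zero_of_periodisation_eq_zero` — **an integrable `φ : ℝ³ → ℝ` whose periodisation over
  a periodic configuration vanishes identically has `∫ φ = 0`** (fundamental-domain bookkeeping:
  `∫ Σ_{x∈F} φ(· − x) = Σ'_{g ∈ G} ∫_D …` by `IsAddFundamentalDomain.integral_eq_tsum''` for the lattice
  of periods acting on `ℝ³`, `integral_tsum`, and the vanishing of the integrand);
* `integral_radial_eq_zero`, `fourier_zero_eq_zero` — hence, by THE INVISIBILITY THEOREM of the sibling
  crux (`Field.field_eq_zero`: the `f`-field `Σ_{y ∈ P} f(|w − y|)` of a witness crystal vanishes at every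
  `w ∈ ℝ³`), **every witness with integrable `F` has `∫_{ℝ³} f(‖v‖) dv = 0`, i.e. `𝓕F(0) = 0`**: the forced
  DOUBLE zero of the non-negative transform `𝓕F` at the origin (conjunct 13 makes `0` its global minimum),
  the `k = 0` instance of "`𝓕F · |S_P|² = 0` on the reciprocal lattice" in closed form
  (`fourier_zero_of_clauses`, registered sub-goal, clauses verbatim);
* `U_eq_zero_iff`, `f_eq_lennardJones_iff` — with conjunct 9, complementary slackness
  (`Slackness.U_eq_zero_of_mem_points`) pins the zero set of `U` on `(0,∞)` and the contact set
  `{f = V_LJ} ∩ [ρ,∞)` to EXACTLY the distance set `D_P ∖ {0}`;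
* `dist_mem_of_energy_le`, `distSet_rigidity_of_strictCertificate` (registered sub-goal) — **DISTANCE-SET
  RIGIDITY: every periodic configuration `Q` with `e_LJ(Q) ≤ e_LJ(P)` (i.e. every periodic minimiser) has
  all its inter-point distances in `D_P`** (the certificate is exact at `Q` too, so `U` vanishes on `D_Q`).
  For the hcp template this is a checkable prediction of the crux: no periodic Lennard-Jones minimiser may
  realise a distance that `hcp(a,h)` does not (e.g. a degenerate fcc/polytype minimiser would refute it).

All `[folklore]`.
-/

noncomputable section

namespace Summit.AtomisticToContinuum.Crystallization.Theorems.BraggSlacknessRigidityStrictCertificate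

open Literature.MathematicalPhysics.StatisticalMechanics
open Summit.AtomisticToContinuum.Crystallization.Theses.BraggSlacknessRigidity
open Summit.AtomisticToContinuum.Crystallization.Theorems.ExactCertificateNegative (IsSplit)
open Summit.AtomisticToContinuum.Crystallization.Theorems.ChargedEnergyGapNegative (E3 eStar eStar_le)
open Summit.AtomisticToContinuum.Crystallization.Theorems.ChargedEnergyGapNegative.Blocks
  (zBasis latVec latVecL latVec_neg)
open Summit.AtomisticToContinuum.Crystallization.Theorems.ThreeConeCertificateExactCertificate.Slackness
  (witness_eq U_eq_zero_of_mem_points f_eq_lennardJones_of_mem_points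
    f_zero_add_two_mul_energyPerParticle_f)
open Summit.AtomisticToContinuum.Crystallization.Theorems.ThreeConeCertificateExactCertificate.Field
  (field_eq_zero summable_coset_of_isSplit periodisation_posType_of_isSplit)
open MeasureTheory
open scoped BigOperators FourierTransform RealInnerProductSpace

/-! ## Periodisation zero ⇒ integral zero -/

/-- **An integrable function whose periodisation over a periodic configuration vanishes identically has
integral zero.**  If `φ : ℝ³ → ℝ` is integrable, its coset sums `Σ_d φ(v − latVec d)` converge, and
`Σ_{x ∈ F} Σ_d φ(w − x − latVec d) = 0` for every `w`, then `∫ φ = 0`: with `Φ := Σ_{x∈F} φ(· − x)`,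
`#F · ∫φ = ∫Φ = Σ'_{g ∈ G} ∫_D Φ(g + w) dw = ∫_D Σ'_g Φ(g + w) dw = ∫_D 0` for a fundamental domain `D` of
the lattice of periods `G` (Mathlib `ZLattice.isAddFundamentalDomain`, `integral_eq_tsum''`,
`integral_tsum`). [folklore] -/
theorem integral_eq_zero_of_periodisation_eq_zero (P : PeriodicConfiguration 3) {φ : E3 → ℝ}
    (hφ : Integrable φ) (hs : ∀ v : E3, Summable fun d : Fin 3 → ℤ => φ (v - latVec P d))
    (hzero : ∀ w : E3, ∑ x ∈ P.motif, ∑' d : Fin 3 → ℤ, φ (w - x - latVec P d) = 0) :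
    ∫ v, φ v = 0 := by
  -- the lattice of periods acting on `ℝ³` by translations, and a fundamental domain
  haveI : MeasurableVAdd P.lattice E3 := (inferInstance : MeasurableVAdd P.lattice.toAddSubgroup E3)
  haveI : VAddInvariantMeasure P.lattice E3 volume :=
    (inferInstance : VAddInvariantMeasure P.lattice.toAddSubgroup E3 volume)
  have hD : IsAddFundamentalDomain P.lattice (ZSpan.fundamentalDomain ((zBasis P).ofZLatticeBasis ℝ))
      (volume : Measure E3) :=
    ZLattice.isAddFundamentalDomain (zBasis P) volume
  set D : Set E3 := ZSpan.fundamentalDomain ((zBasis P).ofZLatticeBasis ℝ) with hDdef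
  -- the motif-summed translate
  set Φ : E3 → ℝ := fun v => ∑ x ∈ P.motif, φ (v - x) with hΦdef
  have hΦi : Integrable Φ := integrable_finsetSum _ fun x _ => hφ.comp_sub_right x
  -- (1) `∫ Φ = #F · ∫ φ`
  have h1 : ∫ v, Φ v = P.motif.card * ∫ v, φ v := by
    rw [hΦdef, integral_finsetSum _ (fun x _ => hφ.comp_sub_right x)]
    simp_rw [integral_sub_right_eq_self φ]
    rw [Finset.sum_const, nsmul_eq_mul]
  -- (2) `∫ Φ = Σ'_g ∫_D Φ(g + w)`
  have h2 : ∫ v, Φ v = ∑' g : P.lattice, ∫ w in D, Φ (g +ᵥ w) := hD.integral_eq_tsum'' Φ hΦi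
  -- (3) swap the lattice sum and the integral
  have h3 : ∑' g : P.lattice, ∫ w in D, Φ (g +ᵥ w) = ∫ w in D, ∑' g : P.lattice, Φ (g +ᵥ w) := by
    refine (integral_tsum (fun g => ?_) ?_).symm
    · exact ((hΦi.comp_add_left (g : E3)).aestronglyMeasurable).restrict
    · rw [← hD.lintegral_eq_tsum'' fun v => ‖Φ v‖ₑ]
      exact hΦi.2.ne
  -- (4) the integrand vanishes identically
  set e : (Fin 3 → ℤ) ≃ P.lattice := (zBasis P).equivFun.symm.toEquiv with hedef
  have he : ∀ d, ((e d : P.lattice) : E3) = latVec P d := fun d => rfl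
  have hpt : ∀ (w x : E3) (d : Fin 3 → ℤ), latVec P d + w - x = w - x - latVec P (-d) := by
    intro w x d
    rw [latVec_neg, sub_neg_eq_add]
    abel
  have hsx : ∀ w x : E3, Summable fun g : P.lattice => φ ((g : E3) + w - x) := by
    intro w x
    refine (e.summable_iff).1 ?_
    have h' : Summable fun d : Fin 3 → ℤ => φ (w - x - latVec P (-d)) :=
      (Equiv.neg (Fin 3 → ℤ)).summable_iff.2 (hs (w - x))
    refine h'.congr fun d => ?_
    show φ (w - x - latVec P (-d)) = φ ((e d : E3) + w - x)
    rw [he, hpt]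
  have h4 : ∀ w : E3, ∑' g : P.lattice, Φ (g +ᵥ w) = 0 := by
    intro w
    have hΦg : (fun g : P.lattice => Φ (g +ᵥ w)) = fun g : P.lattice => ∑ x ∈ P.motif, φ ((g : E3) + w - x) := by
      funext g
      show (∑ x ∈ P.motif, φ ((g : E3) + w - x)) = ∑ x ∈ P.motif, φ ((g : E3) + w - x)
      rfl
    rw [hΦg, Summable.tsum_finsetSum (fun x _ => hsx w x), ← hzero w]
    refine Finset.sum_congr rfl fun x _ => ?_
    calc ∑' g : P.lattice, φ ((g : E3) + w - x)
        = ∑' d : Fin 3 → ℤ, φ ((e d : E3) + w - x) := (e.tsum_eq fun g : P.lattice => φ ((g : E3) + w - x)).symm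
      _ = ∑' d : Fin 3 → ℤ, φ (w - x - latVec P (-d)) := tsum_congr fun d => by rw [he, hpt]
      _ = ∑' d : Fin 3 → ℤ, φ (w - x - latVec P d) :=
          (Equiv.neg (Fin 3 → ℤ)).tsum_eq fun d => φ (w - x - latVec P d)
  -- assemble
  have h5 : (P.motif.card : ℝ) * ∫ v, φ v = 0 := by
    rw [← h1, h2, h3]
    simp [h4]
  have hm : (P.motif.card : ℝ) ≠ 0 := by exact_mod_cast P.motif_nonempty.card_pos.ne'
  exact (mul_eq_zero.1 h5).resolve_left hm

/-! ## The forced zero of `𝓕F` at the origin -/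

/-- **Every witness with integrable `F = f∘‖·‖` has `∫_{ℝ³} f(‖v‖) dv = 0`.**  By the invisibility
theorem (`Field.field_eq_zero`, fed by `summable_coset_of_isSplit`, `periodisation_posType_of_isSplit`
and complementary slackness `f 0 + 2e_f(P) = 0`) the periodisation of `F` over the witness crystal
vanishes identically; apply `integral_eq_zero_of_periodisation_eq_zero`. [folklore] -/
theorem integral_radial_eq_zero {P : PeriodicConfiguration 3} {ρ c : ℝ} {g U f : ℝ → ℝ}
    (hs : IsSplit ρ c g U f) (hv : c + f 0 / 2 ≤ -(P.energyPerParticle lennardJones))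
    (hFi : Integrable fun v : E3 => (f ‖v‖ : ℂ)) : ∫ v : E3, f ‖v‖ = 0 := by
  have hφ : Integrable fun v : E3 => f ‖v‖ := by
    have h := hFi.re
    simpa using h
  have hsum := summable_coset_of_isSplit P hs
  have hz : ∀ w : E3, ∑ x ∈ P.motif, ∑' d : Fin 3 → ℤ, f (dist (w - x) (latVec P d)) = 0 :=
    fun w => field_eq_zero P f hsum (periodisation_posType_of_isSplit P hs)
      (f_zero_add_two_mul_energyPerParticle_f hs hv) w
  refine integral_eq_zero_of_periodisation_eq_zero P hφ (fun v => ?_) (fun w => ?_)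
  · simpa only [dist_eq_norm] using hsum v
  · simpa only [dist_eq_norm] using hz w

/-- **Hence `𝓕F(0) = 0` for every witness with integrable `F`** — the Fourier transform of the Bochner
cone's kernel has a forced zero at the origin (for a strict witness, conjunct 13 `𝓕F ≥ 0` makes it a
global minimum, i.e. a zero of order ≥ 2 in the radial variable). [folklore] -/
theorem fourier_zero_eq_zero {P : PeriodicConfiguration 3} {ρ c : ℝ} {g U f : ℝ → ℝ}
    (hs : IsSplit ρ c g U f) (hv : c + f 0 / 2 ≤ -(P.energyPerParticle lennardJones))
    (hFi : Integrable fun v : E3 => (f ‖v‖ : ℂ)) : 𝓕 (fun v : E3 => (f ‖v‖ : ℂ)) 0 = 0 := by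
  rw [Real.fourier_eq']
  simp only [inner_zero_right, mul_zero, Complex.ofReal_zero, zero_mul, Complex.exp_zero, one_smul]
  rw [integral_complex_ofReal, integral_radial_eq_zero hs hv hFi, Complex.ofReal_zero]

/-- **Registered sub-goal `fourier_zero_of_clauses`** (crux conjuncts 2–7 and 11 verbatim as hypotheses):
`𝓕F(0) = 0` for every witness of `StrictCertificate` (indeed of `ExactCertificate` with integrable `F`).
[folklore] -/
theorem fourier_zero_of_clauses : ∀ (P : Literature.MathematicalPhysics.StatisticalMechanics.PeriodicConfiguration 3) (ρ c : ℝ) (g U f : ℝ → ℝ), (∀ r : ℝ, 0 < r → Literature.MathematicalPhysics.StatisticalMechanics.lennardJones r = g r + U r + f r) → (∀ r : ℝ, 0 < r → 0 ≤ U r) → (∀ r : ℝ, ρ ≤ r → g r = 0) → (∀ (n : ℕ) (y : Fin n → EuclideanSpace ℝ (Fin 3)) (w : Fin n → ℝ), 0 ≤ ∑ i, ∑ j, w i * w j * f (dist (y i) (y j))) → (∀ (N : ℕ) (x : Fin N → EuclideanSpace ℝ (Fin 3)), Function.Injective x → -(c * (N : ℝ)) ≤ Literature.MathematicalPhysics.StatisticalMechanics.interactionEnergy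 g x) → c + f 0 / 2 = -(P.energyPerParticle Literature.MathematicalPhysics.StatisticalMechanics.lennardJones) → MeasureTheory.Integrable (fun v : EuclideanSpace ℝ (Fin 3) => (f ‖v‖ : ℂ)) → FourierTransform.fourier (fun v : EuclideanSpace ℝ (Fin 3) => (f ‖v‖ : ℂ)) 0 = 0 :=
  fun _P _ρ _c _g _U _f h1 h2 h3 h4 h5 h6 hFi => fourier_zero_eq_zero ⟨h1, h2, h3, h4, h5⟩ h6.le hFi

/-! ## Exact zero set of the slack and exact contact set of the tail interpolant -/

/-- **With conjunct 9, the zero set of `U` on `(0,∞)` is EXACTLY `D_P ∖ {0}`** (`⊇` is complementary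
slackness `Slackness.U_eq_zero_of_mem_points`, `⊆` is conjunct 9). [folklore] -/
theorem U_eq_zero_iff {P : PeriodicConfiguration 3} {ρ c : ℝ} {g U f : ℝ → ℝ}
    (hs : IsSplit ρ c g U f) (hv : c + f 0 / 2 ≤ -(P.energyPerParticle lennardJones))
    (h9 : ∀ r : ℝ, 0 < r → U r = 0 → ∃ a ∈ P.points, ∃ b ∈ P.points, r = dist a b)
    {r : ℝ} (hr : 0 < r) :
    U r = 0 ↔ ∃ a ∈ P.points, ∃ b ∈ P.points, r = dist a b := by
  refine ⟨h9 r hr, ?_⟩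
  rintro ⟨a, ha, b, hb, rfl⟩
  exact U_eq_zero_of_mem_points hs hv ha hb (dist_pos.1 hr)

/-- **With conjunct 9, the contact set `{f = V_LJ} ∩ [ρ,∞) ∩ (0,∞)` is EXACTLY `D_P ∩ [ρ,∞) ∖ {0}`**
(`f = V_LJ − U` on the tail, `IsSplit.f_eq_tail`). [folklore] -/
theorem f_eq_lennardJones_iff {P : PeriodicConfiguration 3} {ρ c : ℝ} {g U f : ℝ → ℝ}
    (hs : IsSplit ρ c g U f) (hv : c + f 0 / 2 ≤ -(P.energyPerParticle lennardJones))
    (h9 : ∀ r : ℝ, 0 < r → U r = 0 → ∃ a ∈ P.points, ∃ b ∈ P.points, r = dist a b)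
    {r : ℝ} (hρ : ρ ≤ r) (hr : 0 < r) :
    f r = lennardJones r ↔ ∃ a ∈ P.points, ∃ b ∈ P.points, r = dist a b := by
  rw [← U_eq_zero_iff hs hv h9 hr, hs.f_eq_tail hρ hr]
  constructor <;> intro h <;> linarith

/-! ## Distance-set rigidity of periodic minimisers -/

/-- **Every periodic configuration `Q` at least as good as the witness template has all its distances in
`D_P`.**  If `e_LJ(Q) ≤ e_LJ(P)` then the certificate is exact at `Q` as well (`c + f 0/2 ≤ −e_LJ(Q)`), so
complementary slackness forces `U = 0` on `D_Q ∖ {0}`, and conjunct 9 places these distances in `D_P`.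
[folklore] -/
theorem dist_mem_of_energy_le {P : PeriodicConfiguration 3} {ρ c : ℝ} {g U f : ℝ → ℝ}
    (hs : IsSplit ρ c g U f) (hv : c + f 0 / 2 ≤ -(P.energyPerParticle lennardJones))
    (h9 : ∀ r : ℝ, 0 < r → U r = 0 → ∃ a ∈ P.points, ∃ b ∈ P.points, r = dist a b)
    {Q : PeriodicConfiguration 3}
    (hQ : Q.energyPerParticle lennardJones ≤ P.energyPerParticle lennardJones)
    {p q : E3} (hp : p ∈ Q.points) (hq : q ∈ Q.points) (hpq : p ≠ q) :
    ∃ a ∈ P.points, ∃ b ∈ P.points, dist p q = dist a b :=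
  h9 _ (dist_pos.2 hpq) (U_eq_zero_of_mem_points hs (by linarith) hp hq hpq)

/-- **Registered sub-goal `distSet_rigidity_of_strictCertificate`: `StrictCertificate` forces every periodic
Lennard-Jones configuration at least as good as its hcp template — in particular every periodic minimiser —
to realise only template distances.** [folklore] -/
theorem distSet_rigidity_of_strictCertificate : Summit.AtomisticToContinuum.Crystallization.Theses.BraggSlacknessRigidity.StrictCertificate → ∃ (a h : ℝ) (ha : a ≠ 0) (hh : h ≠ 0), ∀ Q : Literature.MathematicalPhysics.StatisticalMechanics.PeriodicConfiguration 3, Q.energyPerParticle Literature.MathematicalPhysics.StatisticalMechanics.lennardJones ≤ (Literature.MathematicalPhysics.StatisticalMechanics.hcpPeriodicConfiguration ha hh).energyPerParticle Literature.MathematicalPhysics.StatisticalMechanics.lennardJones → ∀ p ∈ Q.points, ∀ q ∈ Q.points, p ≠ q → ∃ x ∈ (Literature.MathematicalPhysics.StatisticalMechanics.hcpPeriodicConfiguration ha hh).points, ∃ y ∈ (Literature.MathematicalPhysics.StatisticalMechanics.hcpPeriodicConfiguration ha hh).points, dist p q = dist x y := by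
  rintro ⟨P, ρ, c, g, U, f, ⟨a, h, ha, hh, rfl⟩, h1, h2, h3, h4, h5, h6, -, h9, -⟩
  exact ⟨a, h, ha, hh, fun Q hQ p hp q hq hpq =>
    dist_mem_of_energy_le ⟨h1, h2, h3, h4, h5⟩ h6.le h9 hQ hp hq hpq⟩

end Summit.AtomisticToContinuum.Crystallization.Theorems.BraggSlacknessRigidityStrictCertificate

end
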